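import Literature.Barriers.CriticalPhenomena.GridSAWAnyLengthDrawingCount
import HarnessLib

/-!
# Barrier `GridSAWCountingSharpPComplete`, squares step: the sites along the realisation of an
# abstract path

Sibling of `GridSAWSquareSites.lean` (square sites `σ` on a congestion-free grid drawing
`(P, D)`; the counting identity `IsSiteList.ncard_saw_withSquares`: the SAWs of the decorated
instance between old points number `Σ_π 2^{#sitesAlong σ π}`, summed over the SAWs `π` of the
drawing) and of `GridSAWAnyLengthDrawingCount.lean` (that sum is a sum over the abstract simple
`s`–`t` paths `l`, at their realisations `realize P D l`: `sum_sawFinset_drawnEdges_eq`;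
`absPathsFromTo`; `pathEdges_append_cons_split`). To evaluate the summand path by path one needs
`#sitesAlong σ (realize P D l)` — the exponent in "for each edge `e` of `G′`, now `e` is realized
by a set of `2^β` paths" [LOT2003, §4, proof of Theorem 7, PDF p. 11] — which this file
computes edge by edge:

* `sitesAlong_eq_union`, `sitesAlong_reverse`, `sitesAlong_orientedPath`,
  `sitesAlong_singleton`;
* `sitesAlong_realize_cons_cons` (the sites along `realize (a :: b :: l)` are those along the
  drawn edge `{a, b}` together with those along `realize (b :: l)`),
  `disjoint_sitesAlong_realize` (disjointly: a site's base point is an interior point of its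
  edge — the consumer of the interiority clause of `IsSiteList`), whence
  **`card_sitesAlong_realize`**: if every drawn edge carries exactly `β` sites, an abstract
  simple path with `m` edges has exactly `β m` sites along its realisation.

Everything here is proved. (`GridSAWAnyLengthDrawingCount.countP_usedBy` counts the drawn edges
a path uses; here the sites are counted directly, which is what the squares step consumes.)

## References

* M. Liśkiewicz, M. Ogihara, S. Toda, *The complexity of counting self-avoiding walks in
  subgraphs of two-dimensional grids and hypercubes*, TCS 304 (2003) 129–156, §4, proof of
  Theorem 7 (fourth type).
-/

namespace Literature.Barriers.CriticalPhenomena.GridSAW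

open Finset

/-! ### Sites along concatenations, reversals, oriented paths -/

/-- The sites along a walk depend only on the set of its consecutive pairs: a walk whose pairs
are those of two walks has the union of their sites along it. [folklore] -/
theorem sitesAlong_eq_union {σ : List SquareSite} {π π₁ π₂ : List GridPoint}
    (h : ∀ e, e ∈ pathEdges π ↔ e ∈ pathEdges π₁ ∨ e ∈ pathEdges π₂) :
    sitesAlong σ π = sitesAlong σ π₁ ∪ sitesAlong σ π₂ := by
  ext s
  simp only [Finset.mem_union, mem_sitesAlong_iff, h]
  tauto

/-- Reversing a walk does not change the sites along it. [folklore] -/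
theorem sitesAlong_reverse (σ : List SquareSite) (π : List GridPoint) :
    sitesAlong σ π.reverse = sitesAlong σ π := by
  ext s
  simp only [mem_sitesAlong_iff, mem_pathEdges_reverse]
  tauto

/-- The sites along the oriented path of a drawn edge are the sites along its path. [folklore] -/
theorem sitesAlong_orientedPath (σ : List SquareSite) (e : DrawnEdge) (a : ℕ) :
    sitesAlong σ (orientedPath e a) = sitesAlong σ e.2.2 := by
  unfold orientedPath
  split_ifs
  · rfl
  · exact sitesAlong_reverse σ _

/-- A one-point walk has no sites along it. [folklore] -/
@[simp] theorem sitesAlong_singleton (σ : List SquareSite) (x : GridPoint) : sitesAlong σ [x] = ∅ := by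
  simp [sitesAlong]

section Drawing

variable {P : List GridPoint} {D : List DrawnEdge} {σ : List SquareSite}

/-- **Sites along a realisation, first step.** For the drawn edge `e = {a, b}`, the sites along
`realize (a :: b :: l)` are the sites along the path of `e` together with the sites along
`realize (b :: l)`. [folklore] -/
theorem sitesAlong_realize_cons_cons (hD : IsGridDrawing P D) {e : DrawnEdge} (he : e ∈ D)
    {a b : ℕ} (hab : HasEnds e a b) (l : List ℕ) :
    sitesAlong σ (realize P D (a :: b :: l)) = sitesAlong σ e.2.2 ∪ sitesAlong σ (realize P D (b :: l)) := by
  have h1 := realize_cons_cons hD he hab l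
  have h2 : realize P D (b :: l) = img P b :: realizeTail D b l := rfl
  have h3 := dropLast_orientedPath_append hD he hab
  rw [← sitesAlong_orientedPath σ e a]
  apply sitesAlong_eq_union
  intro x
  rw [h1, h2, pathEdges_append_cons_split, h3, List.mem_append]

/-- **… and disjointly**: a site along the drawn edge `{a, b}` is not along `realize (b :: l)`
when `a :: b :: l` is an abstract simple path (its base point is an interior point of that
edge, while the points of `realize (b :: l)` lie on the edges between consecutive vertices of
`b :: l` or are vertex images). [folklore] -/
theorem disjoint_sitesAlong_realize (hD : IsGridDrawing P D) (hσ : IsSiteList P D σ)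
    {e : DrawnEdge} (he : e ∈ D) {a b : ℕ} (hab : HasEnds e a b) {l : List ℕ}
    (hpath : IsAbsPath P.length D (a :: b :: l)) :
    Disjoint (sitesAlong σ e.2.2) (sitesAlong σ (realize P D (b :: l))) := by
  rw [Finset.disjoint_left]
  intro s hs₁ hs₂
  obtain ⟨hsσ, h₁⟩ := mem_sitesAlong_iff.mp hs₁
  obtain ⟨-, h₂⟩ := mem_sitesAlong_iff.mp hs₂
  have hpe : s.p ∈ e.2.2 := by
    rcases h₁ with h | h
    · exact (mem_of_mem_pathEdges h).1
    · exact (mem_of_mem_pathEdges h).2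
  have hpP : s.p ∉ P := (hσ.base_not_mem_images hD hsσ).1
  have hpr : s.p ∈ realize P D (b :: l) := by
    rcases h₂ with h | h
    · exact (mem_of_mem_pathEdges h).1
    · exact (mem_of_mem_pathEdges h).2
  have hanot : a ∉ b :: l := (List.nodup_cons.mp hpath.1).1
  have hb : b < P.length := hpath.2.1 b (by simp)
  change s.p ∈ img P b :: realizeTail D b l at hpr
  rcases List.mem_cons.mp hpr with h | h
  · rw [img_eq_getElem hb] at h
    exact hpP (h ▸ List.getElem_mem hb)
  · obtain ⟨e', he', u, w, huw, hu, hw, hpe'⟩ := mem_realizeTail h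
    by_cases hee : e' = e
    · subst hee
      rcases hab.mem_of_hasEnds huw with rfl | rfl
      · exact hanot hu
      · exact hanot (List.mem_cons_of_mem _ hw)
    · exact hpP (hD.mem_of_mem_mem he he' (Ne.symm hee) hpe hpe')

/-- **The number of sites along the realisation of an abstract simple path** with `m` edges
is `β m` when every drawn edge carries exactly `β` sites ("for each edge `e` of `G′`, now `e`
is realized by a set of `2^β` paths": each of the `m` realised edges contributes its `β`
squares). [cite: LiskiewiczOgiharaToda2003, §4 (proof of Theorem 7, E₃)] -/
theorem card_sitesAlong_realize (hD : IsGridDrawing P D) (hσ : IsSiteList P D σ) {β : ℕ}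
    (hunif : ∀ e ∈ D, (sitesAlong σ e.2.2).card = β) :
    ∀ {a : ℕ} {l : List ℕ}, IsAbsPath P.length D (a :: l) →
      (sitesAlong σ (realize P D (a :: l))).card = β * l.length
  | a, [], _ => by simp [realize, realizeTail]
  | a, b :: l, hpath => by
    obtain ⟨e, he, (hab : HasEnds e a b)⟩ := (List.isChain_cons_cons.mp hpath.2.2).1
    have hpath' : IsAbsPath P.length D (b :: l) :=
      ⟨hpath.1.of_cons, fun v hv => hpath.2.1 v (List.mem_cons_of_mem a hv),
        (List.isChain_cons_cons.mp hpath.2.2).2⟩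
    rw [sitesAlong_realize_cons_cons hD he hab,
      Finset.card_union_of_disjoint (disjoint_sitesAlong_realize hD hσ he hab hpath), hunif e he,
      card_sitesAlong_realize hD hσ hunif hpath', List.length_cons]
    ring

end Drawing

end Literature.Barriers.CriticalPhenomena.GridSAW
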